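import Mathlib
import Literature.NumberTheory.LFunctions.Zhang2022.Section10Range1113
import HarnessLib

/-!
# Zhang (2022) §10 p. 57: the top range of the `Θ₁(𝐚₁₁,𝐚₁₃)` block (`Z22:§10.u038`, first line,
# `Typed.Sec10B.Eq1038a`) DISCHARGED from Lemma 10.2, Lemma 8.2, (8.10)

Topic `Literature/NumberTheory/LFunctions/Zhang2022` (Landau–Siegel adjudication tree;
verdict-neutral). Y. Zhang, *Discrete mean estimates and the Landau–Siegel zero*,
arXiv:2211.02515v1 (2022) [Zhang2022LandauSiegel], §10 «Proof of Proposition 2.4», PDF p. 57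
(tex L2941): "the sum over `P^{0.502} ≤ dr < P^{0.504}` is equal to
`(500L′(1,χ)²/(0.504 log²P)) Σ_{P^{0.502}≤n<P^{0.504}} |χ(n)|λ₀ⱼ(n)φ(n)⁻¹𝔣_{j6}(P^{0.504}/n)(1 + 𝔶₂ⱼ(n)) + o(α)`"
(typed by L3-t2 as `Typed.Sec10B.Eq1038a c′`; campaign cell siegel-zhang, DAG node `Z22:§10.u038`,
cone C26 / `Ded1017`). Companion of `Section10Range1113` (the middle range, `eq1037a_of`): the same
route — `n`-sum = `𝔳₂ⱼ(d,r)` evaluated by Lemma 10.2 ((10.10) on `P^{0.502} < dr ≤ P^{0.504}/T`,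
(10.11) on the windows), `m`-sum = Lemma 8.2's sum at `x = P₁/n` over `log P₁`, collapse by (8.10) —
with one difference: on the top window `P^{0.504}/T ≤ n < P^{0.504}` one has `x = P₁/n ≤ T`, where
Lemma 8.2 does not apply, and the `m`-sum is bounded crudely by `(1 + log x)log x/log P₁ ≤ 2𝓛^{2.2}/log P₁`
(`norm_lemma82Sum_crude`); the assembly therefore uses the window variant
`range_assembly_bound₂` of the toolkit. Total error `≪ 𝓛⁻¹¹ = o(α)`.

**Every proposition named is a CLAIM of an unrefereed manuscript under adjudication; this file
proves the implication «Lemma 10.2 ∧ Lemma 8.2 ∧ (8.10) ⇒ the display» only.** No new definitions,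
no named facts; nothing here bears on Theorems 1–2 of the source or on Landau–Siegel zeros.

## References

* Y. Zhang, arXiv:2211.02515v1 (2022), §10 p. 57 (tex L2936–2945), Lemma 10.2 p. 55, Lemma 8.2
  p. 46, (8.10) p. 48. [cite: Zhang2022LandauSiegel, §10 p.57]
-/

noncomputable section

open Complex Real Finset

namespace Literature.NumberTheory.LFunctions.Zhang2022.Skeleton

open Literature.NumberTheory.LFunctions.Zhang2022.Typed
open Literature.NumberTheory.LFunctions.Zhang2022.Section8cProofs (betaJ_eq_real_mul_I beta1_eq
  beta2_eq beta3_eq abs_b_le large_D)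

variable (c' : ℝ) {D : ℕ} (χ : DirichletCharacter ℂ D)

/-! ## Crude bound for Lemma 8.2's sum (for `x ≤ T`, outside the lemma's range) -/

/-- **`|Σ_{m<x} χ(m)m^{β_j−1}(x/m)^{β₆}log(x/m)| ≤ (1 + log x)log x`** for `x ≥ 1` (every term has
modulus `≤ log(x/m)/m ≤ log x/m`; harmonic sum). [cite: Zhang2022LandauSiegel, §8 Lemma 8.2] -/
theorem norm_lemma82Sum_crude (j : ℕ) {x : ℝ} (hx : 1 ≤ x) :
    ‖∑ m ∈ Finset.Ico 1 ⌈x⌉₊, χ (m : ZMod D) / (m : ℂ) ^ (1 - betaJ c' D j) *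
        ((x / m : ℝ) : ℂ) ^ beta6 D * (Real.log (x / m) : ℂ)‖ ≤ (1 + Real.log x) * Real.log x := by
  obtain ⟨b, hb, -⟩ := betaJ_eq_real_mul_I c' D j
  have hx0 : 0 < x := by linarith
  have hlogx : 0 ≤ Real.log x := Real.log_nonneg hx
  have hterm : ∀ m ∈ Finset.Ico 1 ⌈x⌉₊,
      ‖χ (m : ZMod D) / (m : ℂ) ^ (1 - betaJ c' D j) * ((x / m : ℝ) : ℂ) ^ beta6 D *
        (Real.log (x / m) : ℂ)‖ ≤ (1 / (m : ℝ)) * Real.log x := by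
    intro m hm
    have hm1 : 1 ≤ m := (Finset.mem_Ico.mp hm).1
    have hm0 : (0 : ℝ) < m := by exact_mod_cast hm1
    have hmx : (m : ℝ) ≤ x := by
      have h1 : m + 1 ≤ ⌈x⌉₊ := (Finset.mem_Ico.mp hm).2
      have h2 : (m : ℝ) + 1 ≤ ⌈x⌉₊ := by exact_mod_cast h1
      have h3 := Nat.ceil_lt_add_one hx0.le
      linarith
    have hχ : ‖χ (m : ZMod D)‖ ≤ 1 := DirichletCharacter.norm_le_one χ _
    have hpow : ‖(m : ℂ) ^ (1 - betaJ c' D j)‖ = m := by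
      rw [Complex.norm_natCast_cpow_of_pos hm1]
      simp [hb]
    have hx' : ‖((x / m : ℝ) : ℂ) ^ beta6 D‖ = 1 := by
      rw [Complex.norm_cpow_eq_rpow_re_of_pos (div_pos hx0 hm0)]
      simp [beta6]
    have hlog : ‖(Real.log (x / m) : ℂ)‖ ≤ Real.log x := by
      rw [Complex.norm_real, Real.norm_eq_abs, abs_of_nonneg (Real.log_nonneg (by
        rw [le_div_iff₀ hm0]; linarith))]
      rw [Real.log_div hx0.ne' hm0.ne']
      linarith [Real.log_nonneg (show (1:ℝ) ≤ m by exact_mod_cast hm1)]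
    rw [norm_mul, norm_mul, norm_div, hpow, hx', mul_one]
    calc ‖χ (m : ZMod D)‖ / m * ‖(Real.log (x / m) : ℂ)‖ ≤ 1 / m * Real.log x := by gcongr
      _ = 1 / (m : ℝ) * Real.log x := rfl
  refine (norm_sum_le _ _).trans ((Finset.sum_le_sum hterm).trans ?_)
  rw [← Finset.sum_mul]
  gcongr
  -- harmonic: `Σ_{1 ≤ m < ⌈x⌉} 1/m ≤ 1 + log x`
  have hIco : Finset.Ico 1 ⌈x⌉₊ = Finset.Ioc 0 (⌈x⌉₊ - 1) := by
    ext m; simp only [Finset.mem_Ico, Finset.mem_Ioc]; omega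
  rw [hIco]
  refine (sum_Ioc_inv_le_log (Nat.zero_le _)).trans ?_
  simp only [Nat.cast_zero, zero_add, Real.log_one, sub_zero]
  rcases Nat.eq_zero_or_pos (⌈x⌉₊ - 1) with h0 | hpos
  · rw [h0, Nat.cast_zero, Real.log_zero]; linarith
  · have hcast : ((⌈x⌉₊ - 1 : ℕ) : ℝ) = (⌈x⌉₊ : ℝ) - 1 := by
      rw [Nat.cast_sub (by omega), Nat.cast_one]
    have hle : ((⌈x⌉₊ - 1 : ℕ) : ℝ) ≤ x := by
      rw [hcast]; linarith [Nat.ceil_lt_add_one hx0.le]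
    have hpos' : (0 : ℝ) < ((⌈x⌉₊ - 1 : ℕ) : ℝ) := by exact_mod_cast hpos
    linarith [Real.log_le_log hpos' hle]

/-! ## `|1 + 𝔶₂ⱼ(y)| ≤ 2` -/

/-- **`|1 + 𝔶₂ⱼ(y)| ≤ 2`** when `|log(P^{0.504}/y)| ≤ 0.004𝓛⁹` (once `|c′|α𝓛 ≤ 1`).
[cite: Zhang2022LandauSiegel, §10 (10.10)] -/
theorem norm_fraky2_add_le {c' : ℝ} {D : ℕ} (h : |c'| * alpha D * ell D ≤ 1) (hα : 0 < alpha D)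
    (hαL : alpha D * ell D ^ 9 = π) (hℓ : 0 ≤ ell D) (j : ℕ) {y : ℝ}
    (h2 : |Real.log (bigP D ^ (0.504 : ℝ) / y)| ≤ 0.004 * ell D ^ 9) :
    ‖1 + fraky2 c' D j y‖ ≤ 2 := by
  have hb1 := norm_betaJ_le h hα.le hℓ (j + 1)
  have hb2 := norm_betaJ_le h hα.le hℓ (j + 2)
  set A : ℝ := 0.004 * ell D ^ 9 with hA
  have hA0 : 0 ≤ A := by positivity
  have hαA : alpha D * A = 0.004 * π := by rw [hA, ← hαL]; ring
  have t1 : ‖(betaJ c' D (j + 1) + betaJ c' D (j + 2)) *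
      (Real.log (bigP D ^ (0.504 : ℝ) / y) : ℂ)‖ ≤ 12 * alpha D * A := by
    rw [norm_mul, Complex.norm_real, Real.norm_eq_abs]
    calc ‖betaJ c' D (j + 1) + betaJ c' D (j + 2)‖ * |Real.log (bigP D ^ (0.504 : ℝ) / y)|
        ≤ (6 * alpha D + 6 * alpha D) * A := by
          gcongr
          exact (norm_add_le _ _).trans (add_le_add hb1 hb2)
      _ = 12 * alpha D * A := by ring
  have t2 : ‖betaJ c' D (j + 1) * betaJ c' D (j + 2) / 2 *
      (Real.log (bigP D ^ (0.504 : ℝ) / y) : ℂ) ^ 2‖ ≤ 18 * alpha D ^ 2 * A ^ 2 := by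
    rw [norm_mul, norm_div, norm_mul, Complex.norm_two, norm_pow, Complex.norm_real,
      Real.norm_eq_abs]
    calc ‖betaJ c' D (j + 1)‖ * ‖betaJ c' D (j + 2)‖ / 2 * |Real.log (bigP D ^ (0.504 : ℝ) / y)| ^ 2
        ≤ 6 * alpha D * (6 * alpha D) / 2 * A ^ 2 := by gcongr
      _ = 18 * alpha D ^ 2 * A ^ 2 := by ring
  rw [fraky2]
  calc ‖1 + ((betaJ c' D (j + 1) + betaJ c' D (j + 2)) *
          (Real.log (bigP D ^ (0.504 : ℝ) / y) : ℂ) +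
        betaJ c' D (j + 1) * betaJ c' D (j + 2) / 2 *
          (Real.log (bigP D ^ (0.504 : ℝ) / y) : ℂ) ^ 2)‖
      ≤ ‖(1 : ℂ)‖ + (‖(betaJ c' D (j + 1) + betaJ c' D (j + 2)) *
          (Real.log (bigP D ^ (0.504 : ℝ) / y) : ℂ)‖ +
        ‖betaJ c' D (j + 1) * betaJ c' D (j + 2) / 2 *
          (Real.log (bigP D ^ (0.504 : ℝ) / y) : ℂ) ^ 2‖) :=
        (norm_add_le _ _).trans (add_le_add le_rfl (norm_add_le _ _))
    _ ≤ 1 + (12 * alpha D * A + 18 * alpha D ^ 2 * A ^ 2) := by rw [norm_one]; gcongr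
    _ = 1 + (12 * (0.004 * π) + 18 * (0.004 * π) ^ 2) := by rw [← hαA]; ring
    _ ≤ 2 := by nlinarith [Real.pi_lt_four, Real.pi_pos]

/-! ## Generic weight sums over an exponential range and its windows -/

/-- For `1 ≤ A`, `A + 1 ≤ B` and any set `S` of integers in `[e^A, e^B)`:
`Σ_{n∈S} (n/φ(n))^k/n ≤ e^{2^{k+1}}(2 + (B − A))`. [cite: Zhang2022LandauSiegel, §10 p. 57] -/
theorem weight_sum_exp_range (k : ℕ) {A B : ℝ} (hA : 1 ≤ A) (hAB : A + 1 ≤ B) (S : Finset ℕ)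
    (hS : ∀ n ∈ S, 1 ≤ n ∧ Real.exp A ≤ (n : ℝ) ∧ (n : ℝ) < Real.exp B) :
    ∑ n ∈ S, ((n : ℝ) / Nat.totient n) ^ k / n ≤ Real.exp (2 ^ (k + 1)) * (2 + (B - A)) := by
  set lo : ℝ := Real.exp A with hlo
  set hi : ℝ := Real.exp B with hhi
  have hlo0 : 0 < lo := Real.exp_pos _
  have hhi0 : 0 < hi := Real.exp_pos _
  have hlo2 : (2 : ℝ) ≤ lo := by
    calc (2 : ℝ) ≤ Real.exp 1 := by have := Real.exp_one_gt_d9; linarith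
      _ ≤ Real.exp A := Real.exp_le_exp.mpr hA
  have hceil_lo : 2 ≤ ⌈lo⌉₊ := by
    have : (2 : ℝ) ≤ ⌈lo⌉₊ := hlo2.trans (Nat.le_ceil lo)
    exact_mod_cast this
  have hlohi : lo + 1 ≤ hi := by
    have h2 : (2 : ℝ) ≤ Real.exp (B - A) := by
      calc (2 : ℝ) ≤ Real.exp 1 := by have := Real.exp_one_gt_d9; linarith
        _ ≤ Real.exp (B - A) := Real.exp_le_exp.mpr (by linarith)
    have hgap : lo * 2 ≤ hi := by
      calc lo * 2 ≤ lo * Real.exp (B - A) := mul_le_mul_of_nonneg_left h2 hlo0.le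
        _ = hi := by rw [hlo, hhi, ← Real.exp_add]; congr 1; ring
    linarith
  clear_value lo hi
  obtain ⟨Y₀, hY₀⟩ : ∃ Y₀ : ℕ, Y₀ = ⌈lo⌉₊ - 1 := ⟨_, rfl⟩
  obtain ⟨X₀, hX₀⟩ : ∃ X₀ : ℕ, X₀ = ⌊hi⌋₊ := ⟨_, rfl⟩
  have hY₀1 : 1 ≤ Y₀ := by rw [hY₀]; omega
  have hY₀cast : (Y₀ : ℝ) = (⌈lo⌉₊ : ℝ) - 1 := by
    rw [hY₀, Nat.cast_sub (by omega), Nat.cast_one]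
  have hY₀real : lo - 1 ≤ (Y₀ : ℝ) := by
    rw [hY₀cast]; exact sub_le_sub_right (Nat.le_ceil lo) 1
  have hX₀le : (X₀ : ℝ) ≤ hi := by rw [hX₀]; exact Nat.floor_le hhi0.le
  have hY₀X₀ : Y₀ ≤ X₀ := by
    have : (Y₀ : ℝ) ≤ X₀ := by
      have hx : hi - 1 ≤ (X₀ : ℝ) := by
        have hX₀cast : (X₀ : ℝ) = ⌊hi⌋₊ := by rw [hX₀]
        have := Nat.lt_floor_add_one hi
        linarith
      have hy : (Y₀ : ℝ) ≤ lo := by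
        have := Nat.ceil_lt_add_one hlo0.le
        linarith [hY₀cast]
      linarith
    exact_mod_cast this
  have hS_sub : S ⊆ Finset.Ioc Y₀ X₀ := by
    intro n hn
    obtain ⟨hn1, hlon, hnhi⟩ := hS n hn
    rw [Finset.mem_Ioc, hY₀, hX₀]
    constructor
    · have : ⌈lo⌉₊ ≤ n := Nat.ceil_le.mpr hlon
      omega
    · exact Nat.le_floor hnhi.le
  have h1 := sum_ratio_pow_div_le k hY₀1 hY₀X₀
  have hX₀log : Real.log X₀ ≤ B := by
    have hX₀pos : (0 : ℝ) < X₀ := by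
      have : (1 : ℝ) ≤ X₀ := by exact_mod_cast le_trans hY₀1 hY₀X₀
      linarith
    calc Real.log X₀ ≤ Real.log hi := Real.log_le_log hX₀pos hX₀le
      _ = B := by rw [hhi]; exact Real.log_exp B
  have hY₀log : A - 1 ≤ Real.log Y₀ := by
    have h2 : lo / 2 ≤ Y₀ := by linarith
    have hl : Real.log (lo / 2) = A - Real.log 2 := by
      rw [Real.log_div hlo0.ne' (by norm_num), hlo, Real.log_exp]
    have hlog2 : Real.log 2 ≤ 1 := by have := Real.log_two_lt_d9; linarith
    calc A - 1 ≤ Real.log (lo / 2) := by rw [hl]; linarith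
      _ ≤ Real.log Y₀ := Real.log_le_log (by linarith) h2
  calc ∑ n ∈ S, ((n : ℝ) / Nat.totient n) ^ k / n
      ≤ ∑ n ∈ Finset.Ioc Y₀ X₀, ((n : ℝ) / Nat.totient n) ^ k / n :=
        Finset.sum_le_sum_of_subset_of_nonneg hS_sub fun n _ _ => by positivity
    _ ≤ Real.exp (2 ^ (k + 1)) * (1 + Real.log X₀ - Real.log Y₀) := h1
    _ ≤ Real.exp (2 ^ (k + 1)) * (2 + (B - A)) := by gcongr; linarith

/-- For `1 ≤ A ≤ B`, `τ ≥ 0` with `B − τ ≥ 1`... precisely `e^{B−τ} ≥ 2`, and any set `S` of integers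
`n` with either `e^A ≤ n ≤ e^A` or `e^{B−τ} ≤ n < e^B` (the two "windows"):
`Σ_{n∈S}(n/φ(n))^k/n ≤ e^{2^{k+1}}(5 + τ)`. [cite: Zhang2022LandauSiegel, §10 p. 57] -/
theorem weight_sum_windows (k : ℕ) {A B τ : ℝ} (hA : 1 ≤ A) (hτ : 0 ≤ τ) (hBτ : 1 ≤ B - τ)
    (S : Finset ℕ)
    (hS : ∀ n ∈ S, 1 ≤ n ∧ ((Real.exp A ≤ (n : ℝ) ∧ (n : ℝ) ≤ Real.exp A) ∨
      (Real.exp (B - τ) ≤ (n : ℝ) ∧ (n : ℝ) < Real.exp B))) :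
    ∑ n ∈ S, ((n : ℝ) / Nat.totient n) ^ k / n ≤ Real.exp (2 ^ (k + 1)) * (5 + τ) := by
  set lo : ℝ := Real.exp A with hlo
  set hi : ℝ := Real.exp B with hhi
  set wl : ℝ := Real.exp (B - τ) with hwl
  have hlo0 : 0 < lo := Real.exp_pos _
  have hhi0 : 0 < hi := Real.exp_pos _
  have hwl0 : 0 < wl := Real.exp_pos _
  have htwo : ∀ {u : ℝ}, 1 ≤ u → (2 : ℝ) ≤ Real.exp u := fun {u} hu => by
    calc (2 : ℝ) ≤ Real.exp 1 := by have := Real.exp_one_gt_d9; linarith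
      _ ≤ Real.exp u := Real.exp_le_exp.mpr hu
  have hlo2 : (2 : ℝ) ≤ lo := htwo hA
  have hwl2 : (2 : ℝ) ≤ wl := htwo hBτ
  have hwlhi : wl ≤ hi := Real.exp_le_exp.mpr (by linarith)
  have hlogwl : Real.log wl = B - τ := by rw [hwl, Real.log_exp]
  have hloghi : Real.log hi = B := by rw [hhi, Real.log_exp]
  clear_value lo hi wl
  have hceil_lo : 2 ≤ ⌈lo⌉₊ := by
    have : (2 : ℝ) ≤ ⌈lo⌉₊ := hlo2.trans (Nat.le_ceil lo); exact_mod_cast this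
  -- window sets
  set Aset : Finset ℕ := Finset.Ioc (⌈lo⌉₊ - 1) ⌈lo⌉₊ with hAset
  set Bset : Finset ℕ := Finset.Ioc (⌈wl⌉₊ - 1) ⌊hi⌋₊ with hBset
  have hsub : S ⊆ Aset ∪ Bset := by
    intro n hn
    obtain ⟨hn1, hwin⟩ := hS n hn
    rw [Finset.mem_union]
    rcases hwin with ⟨h1, h2⟩ | ⟨h1, h2⟩
    · left
      rw [hAset, Finset.mem_Ioc]
      have hceq : ⌈lo⌉₊ ≤ n := Nat.ceil_le.mpr h1
      have hle : n ≤ ⌈lo⌉₊ := by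
        have : (n : ℝ) ≤ ⌈lo⌉₊ := h2.trans (Nat.le_ceil lo); exact_mod_cast this
      omega
    · right
      rw [hBset, Finset.mem_Ioc]
      have hceq : ⌈wl⌉₊ ≤ n := Nat.ceil_le.mpr h1
      exact ⟨by omega, Nat.le_floor h2.le⟩
  have hk := Real.exp_pos (2 ^ (k + 1) : ℝ)
  -- the one-point window
  have hA_le : ∑ n ∈ Aset, ((n : ℝ) / Nat.totient n) ^ k / n ≤ Real.exp (2 ^ (k + 1)) * 2 := by
    have hApos : 1 ≤ ⌈lo⌉₊ - 1 := by omega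
    have h1 := sum_ratio_pow_div_le k hApos (Nat.sub_le ⌈lo⌉₊ 1)
    refine h1.trans ?_
    gcongr
    have hm : (2 : ℝ) ≤ (⌈lo⌉₊ : ℝ) := by exact_mod_cast hceil_lo
    have hcast : ((⌈lo⌉₊ - 1 : ℕ) : ℝ) = (⌈lo⌉₊ : ℝ) - 1 := by
      rw [Nat.cast_sub (by omega), Nat.cast_one]
    have hq : Real.log (⌈lo⌉₊ : ℝ) - Real.log ((⌈lo⌉₊ : ℝ) - 1) ≤ 1 := by
      rw [← Real.log_div (by linarith) (by linarith)]
      have h0 : 0 < (⌈lo⌉₊ : ℝ) / ((⌈lo⌉₊ : ℝ) - 1) := by apply div_pos <;> linarith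
      have := Real.log_le_sub_one_of_pos h0
      have hm1 : (⌈lo⌉₊ : ℝ) - 1 ≠ 0 := by linarith
      have hq' : (⌈lo⌉₊ : ℝ) / ((⌈lo⌉₊ : ℝ) - 1) - 1 = 1 / ((⌈lo⌉₊ : ℝ) - 1) := by
        field_simp; ring
      rw [hq'] at this
      have : 1 / ((⌈lo⌉₊ : ℝ) - 1) ≤ 1 := by rw [div_le_one (by linarith)]; linarith
      linarith
    have hlogeq : Real.log (((⌈lo⌉₊ - 1 : ℕ) : ℝ)) = Real.log ((⌈lo⌉₊ : ℝ) - 1) := by rw [hcast]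
    linarith [hlogeq, hq]
  -- the top window
  have hB_le : ∑ n ∈ Bset, ((n : ℝ) / Nat.totient n) ^ k / n ≤
      Real.exp (2 ^ (k + 1)) * (3 + τ) := by
    have hceil_wl : 2 ≤ ⌈wl⌉₊ := by
      have : (2 : ℝ) ≤ ⌈wl⌉₊ := hwl2.trans (Nat.le_ceil wl); exact_mod_cast this
    have hBpos : 1 ≤ ⌈wl⌉₊ - 1 := by omega
    rcases Nat.lt_or_ge ⌊hi⌋₊ (⌈wl⌉₊ - 1) with hlt | hle
    · -- empty window
      have : Bset = ∅ := by
        rw [hBset]; exact Finset.Ioc_eq_empty (not_lt.mpr hlt.le)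
      rw [this, Finset.sum_empty]
      positivity
    · have h1 := sum_ratio_pow_div_le k hBpos hle
      refine h1.trans ?_
      gcongr
      have hX : Real.log (⌊hi⌋₊ : ℝ) ≤ B := by
        have hpos : (0 : ℝ) < ⌊hi⌋₊ := by
          have : (1 : ℝ) ≤ ⌊hi⌋₊ := by exact_mod_cast le_trans hBpos hle
          linarith
        calc Real.log (⌊hi⌋₊ : ℝ) ≤ Real.log hi := Real.log_le_log hpos (Nat.floor_le hhi0.le)
          _ = B := hloghi
      have hY : B - τ - 1 ≤ Real.log (((⌈wl⌉₊ - 1 : ℕ) : ℝ)) := by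
        have hcast : ((⌈wl⌉₊ - 1 : ℕ) : ℝ) = (⌈wl⌉₊ : ℝ) - 1 := by
          rw [Nat.cast_sub (by omega), Nat.cast_one]
        have h2 : wl / 2 ≤ ((⌈wl⌉₊ - 1 : ℕ) : ℝ) := by
          rw [hcast]; linarith [Nat.le_ceil wl]
        have hl : Real.log (wl / 2) = B - τ - Real.log 2 := by
          rw [Real.log_div hwl0.ne' (by norm_num), hlogwl]
        have hlog2 : Real.log 2 ≤ 1 := by have := Real.log_two_lt_d9; linarith
        calc B - τ - 1 ≤ Real.log (wl / 2) := by rw [hl]; linarith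
          _ ≤ Real.log (((⌈wl⌉₊ - 1 : ℕ) : ℝ)) := Real.log_le_log (by linarith) h2
      linarith
  calc ∑ n ∈ S, ((n : ℝ) / Nat.totient n) ^ k / n
      ≤ ∑ n ∈ Aset ∪ Bset, ((n : ℝ) / Nat.totient n) ^ k / n :=
        Finset.sum_le_sum_of_subset_of_nonneg hsub fun n _ _ => by positivity
    _ ≤ ∑ n ∈ Aset, ((n : ℝ) / Nat.totient n) ^ k / n +
        ∑ n ∈ Bset, ((n : ℝ) / Nat.totient n) ^ k / n := by
        rw [← Finset.sum_union_inter]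
        have : 0 ≤ ∑ n ∈ Aset ∩ Bset, ((n : ℝ) / Nat.totient n) ^ k / n :=
          Finset.sum_nonneg fun n _ => by positivity
        linarith
    _ ≤ Real.exp (2 ^ (k + 1)) * 2 + Real.exp (2 ^ (k + 1)) * (3 + τ) := add_le_add hA_le hB_le
    _ = Real.exp (2 ^ (k + 1)) * (5 + τ) := by ring

/-! ## Range facts for `P^{0.502} ≤ n < P^{0.504}` -/

/-- For `𝓛 ≥ 5` and `P^{0.502} ≤ n < P^{0.504} = P₁`: `x = P₁/n ∈ (1, P^{0.002}]`, so `x < P`,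
`0 ≤ log x ≤ 0.002𝓛⁹`; if moreover `n < P₁/T` then `T < x`, and if `n ≥ P₁/T` then `log x ≤ 𝓛^{1.1}`.
[cite: Zhang2022LandauSiegel, §10 p. 57] -/
theorem range_xfacts_top {D : ℕ} (hL5 : 5 ≤ ell D) {n : ℕ} (hn1 : 1 ≤ n)
    (hlon : bigP D ^ (0.502 : ℝ) ≤ (n : ℝ)) (hnhi : (n : ℝ) < bigP D ^ (0.504 : ℝ)) :
    1 ≤ P1 D / n ∧ P1 D / n < bigP D ∧ 0 ≤ Real.log (P1 D / n) ∧
      Real.log (P1 D / n) ≤ 0.002 * ell D ^ 9 ∧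
      |Real.log (bigP D ^ (0.504 : ℝ) / n)| ≤ 0.004 * ell D ^ 9 ∧
      ((n : ℝ) < bigP D ^ (0.504 : ℝ) / bigT D → bigT D < P1 D / n) ∧
      (bigP D ^ (0.504 : ℝ) / bigT D ≤ (n : ℝ) → Real.log (P1 D / n) ≤ ell D ^ (1.1 : ℝ)) := by
  have hL0 : (0 : ℝ) < ell D := by linarith
  have hn0 : (0 : ℝ) < n := by exact_mod_cast hn1
  have hlo_exp : bigP D ^ (0.502 : ℝ) = Real.exp (0.502 * ell D ^ 9) := bigP_rpow D 0.502
  have hP1_exp : P1 D = Real.exp (0.504 * ell D ^ 9) := bigP_rpow D 0.504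
  have hP1eq : bigP D ^ (0.504 : ℝ) = P1 D := rfl
  have hlo0 : 0 < bigP D ^ (0.502 : ℝ) := by rw [hlo_exp]; exact Real.exp_pos _
  have hP1pos : 0 < P1 D := by rw [hP1_exp]; exact Real.exp_pos _
  have hT0 : 0 < bigT D := Real.exp_pos _
  have hlogn_lo : 0.502 * ell D ^ 9 ≤ Real.log n := by
    rw [← Real.log_exp (0.502 * ell D ^ 9), ← hlo_exp]; exact Real.log_le_log hlo0 hlon
  have hlogn_hi : Real.log n < 0.504 * ell D ^ 9 := by
    rw [← Real.log_exp (0.504 * ell D ^ 9), ← hP1_exp]; rw [hP1eq] at hnhi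
    exact Real.log_lt_log hn0 hnhi
  have hlogx : Real.log (P1 D / n) = 0.504 * ell D ^ 9 - Real.log n := by
    rw [Real.log_div hP1pos.ne' hn0.ne', hP1_exp, Real.log_exp]
  have hlogT : Real.log (bigT D) = ell D ^ (1.1 : ℝ) := by rw [bigT, Real.log_exp]
  have hL9 : (0 : ℝ) < ell D ^ 9 := by positivity
  have hx0 : 0 < P1 D / n := div_pos hP1pos hn0
  refine ⟨?_, ?_, ?_, ?_, ?_, ?_, ?_⟩
  · rw [le_div_iff₀ hn0, one_mul, ← hP1eq]; exact hnhi.le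
  · rw [← Real.exp_log hx0, bigP, Real.exp_lt_exp, hlogx]; linarith
  · rw [hlogx]; linarith
  · rw [hlogx]; linarith
  · rw [hP1eq, hlogx, abs_le]; constructor <;> linarith
  · intro hmain
    rw [hP1eq, lt_div_iff₀ hT0] at hmain
    rw [lt_div_iff₀ hn0]
    linarith [mul_comm (n : ℝ) (bigT D)]
  · intro hwin
    rw [hP1eq, div_le_iff₀ hT0] at hwin
    rw [← hlogT, hlogx]
    have : Real.log (P1 D) ≤ Real.log ((n : ℝ) * bigT D) :=
      Real.log_le_log hP1pos hwin
    rw [Real.log_mul hn0.ne' hT0.ne', hP1_exp, Real.log_exp] at this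
    linarith

/-! ## The constants of the top range -/

/-- Coefficient sizes for the top range (`𝓛 ≥ 5`): main coefficient `≤ K₁𝓛⁻²²` (as in the middle
range) and window coefficient `B_W e_W + B_M|c₀|·2 ≤ K₂′𝓛⁻¹²` with `B_W = 4𝓛⁻⁵`,
`e_W = (4000e^{9/2} + |C₁|)𝓛⁻⁷`. [cite: Zhang2022LandauSiegel, §10 p. 57] -/
theorem consts_bound_top {L C₁ C₂ c0 : ℝ} (hL5 : 5 ≤ L) (hc0 : 0 ≤ c0)
    (hc0le : c0 ≤ 2000 * Real.exp (9 / 2) * (L ^ 7)⁻¹) :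
    (4 * Real.exp (9 / 2) * L ^ 2 * 32 / (0.504 * L ^ 9) + |C₂| * (L ^ 6)⁻¹ / (0.504 * L ^ 9)) *
          (|C₁| * (L ^ 15)⁻¹) + |C₂| * (L ^ 6)⁻¹ / (0.504 * L ^ 9) * c0 * 2 ≤
        ((254 * Real.exp (9 / 2) + 2 * |C₂|) * |C₁| + 8000 * Real.exp (9 / 2) * |C₂|) * (L ^ 22)⁻¹ ∧
      4 * (L ^ 5)⁻¹ * ((4000 * Real.exp (9 / 2) + |C₁|) * (L ^ 7)⁻¹) +
          4 * Real.exp (9 / 2) * L ^ 2 * 32 / (0.504 * L ^ 9) * c0 * 2 ≤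
        (4 * (4000 * Real.exp (9 / 2) + |C₁|) +
          1016000 * (Real.exp (9 / 2) * Real.exp (9 / 2))) * (L ^ 12)⁻¹ := by
  obtain ⟨h1, -⟩ := consts_bound (C₁ := C₁) (C₂ := C₂) hL5 hc0 hc0le
  refine ⟨h1, ?_⟩
  have hL1 : (1 : ℝ) ≤ L := by linarith
  have hL0 : (0 : ℝ) < L := by linarith
  have hBM' : 4 * Real.exp (9 / 2) * L ^ 2 * 32 / (0.504 * L ^ 9) ≤
      254 * Real.exp (9 / 2) * (L ^ 7)⁻¹ := by
    rw [div_eq_mul_inv]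
    have : (4 * Real.exp (9 / 2) * L ^ 2 * 32) * (0.504 * L ^ 9)⁻¹ =
        (128 / 0.504) * Real.exp (9 / 2) * (L ^ 7)⁻¹ := by
      field_simp
      norm_num
    rw [this]
    have h254 : (128 : ℝ) / 0.504 ≤ 254 := by norm_num
    exact mul_le_mul_of_nonneg_right (mul_le_mul_of_nonneg_right h254 (by positivity))
      (by positivity)
  have hprod12 : (L ^ 5)⁻¹ * (L ^ 7)⁻¹ = (L ^ 12)⁻¹ := by rw [← mul_inv, ← pow_add]
  have hprod14 : (L ^ 7)⁻¹ * (L ^ 7)⁻¹ = (L ^ 14)⁻¹ := by rw [← mul_inv, ← pow_add]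
  have h1412 : (L ^ 14)⁻¹ ≤ (L ^ 12)⁻¹ := by
    rw [inv_le_inv₀ (by positivity) (by positivity)]
    exact pow_le_pow_right₀ hL1 (by norm_num)
  have t1 : 4 * (L ^ 5)⁻¹ * ((4000 * Real.exp (9 / 2) + |C₁|) * (L ^ 7)⁻¹) =
      4 * (4000 * Real.exp (9 / 2) + |C₁|) * (L ^ 12)⁻¹ := by
    rw [← hprod12]; ring
  have t2 : 4 * Real.exp (9 / 2) * L ^ 2 * 32 / (0.504 * L ^ 9) * c0 * 2 ≤
      1016000 * (Real.exp (9 / 2) * Real.exp (9 / 2)) * (L ^ 12)⁻¹ := by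
    calc 4 * Real.exp (9 / 2) * L ^ 2 * 32 / (0.504 * L ^ 9) * c0 * 2
        ≤ (254 * Real.exp (9 / 2) * (L ^ 7)⁻¹) * (2000 * Real.exp (9 / 2) * (L ^ 7)⁻¹) * 2 := by
          gcongr
      _ = 1016000 * (Real.exp (9 / 2) * Real.exp (9 / 2)) * ((L ^ 7)⁻¹ * (L ^ 7)⁻¹) := by ring
      _ = 1016000 * (Real.exp (9 / 2) * Real.exp (9 / 2)) * (L ^ 14)⁻¹ := by rw [hprod14]
      _ ≤ 1016000 * (Real.exp (9 / 2) * Real.exp (9 / 2)) * (L ^ 12)⁻¹ := by gcongr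
  rw [t1]
  linarith

/-- The final numeric step for the top range: `W₁A₁ + W₂A₂ ≤ επ𝓛⁻⁹` for `W₁ ≤ e^{64}𝓛⁹`,
`A₁ ≤ K₁𝓛⁻²²`, `W₂ ≤ 2e^{256}𝓛²`, `A₂ ≤ K₂𝓛⁻¹²`, once `𝓛 ≥ (e^{64}K₁ + 2e^{256}K₂)/(επ)`.
[cite: Zhang2022LandauSiegel, §10 p. 57] -/
theorem final_bound_top {L ε K₁ K₂ W₁ W₂ A₁ A₂ : ℝ} (hL1 : 1 ≤ L) (hε : 0 < ε) (hK₁ : 0 ≤ K₁)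
    (hK₂ : 0 ≤ K₂) (hA₁0 : 0 ≤ A₁) (hA₂0 : 0 ≤ A₂)
    (hW₁ : W₁ ≤ Real.exp 64 * L ^ 9) (hW₂ : W₂ ≤ 2 * Real.exp 256 * L ^ 2)
    (hA₁ : A₁ ≤ K₁ * (L ^ 22)⁻¹) (hA₂ : A₂ ≤ K₂ * (L ^ 12)⁻¹)
    (hLX : (Real.exp 64 * K₁ + 2 * Real.exp 256 * K₂) / (ε * π) ≤ L) :
    W₁ * A₁ + W₂ * A₂ ≤ ε * (π / L ^ 9) := by
  have hL0 : 0 < L := by linarith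
  set K : ℝ := Real.exp 64 * K₁ + 2 * Real.exp 256 * K₂ with hK
  have hK0 : 0 ≤ K := by positivity
  have step1 : W₁ * A₁ + W₂ * A₂ ≤
      (Real.exp 64 * L ^ 9) * (K₁ * (L ^ 22)⁻¹) + (2 * Real.exp 256 * L ^ 2) * (K₂ * (L ^ 12)⁻¹) := by
    gcongr
  have e1 : Real.exp 64 * L ^ 9 * (K₁ * (L ^ 22)⁻¹) = Real.exp 64 * K₁ * (L ^ 13)⁻¹ := by
    field_simp
  have e2 : 2 * Real.exp 256 * L ^ 2 * (K₂ * (L ^ 12)⁻¹) = 2 * Real.exp 256 * K₂ * (L ^ 10)⁻¹ := by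
    field_simp
  have h1310 : (L ^ 13)⁻¹ ≤ (L ^ 10)⁻¹ := by
    rw [inv_le_inv₀ (by positivity) (by positivity)]
    exact pow_le_pow_right₀ hL1 (by norm_num)
  have step2 : Real.exp 64 * K₁ * (L ^ 13)⁻¹ + 2 * Real.exp 256 * K₂ * (L ^ 10)⁻¹ ≤
      K * (L ^ 10)⁻¹ := by
    rw [hK, add_mul]
    have : Real.exp 64 * K₁ * (L ^ 13)⁻¹ ≤ Real.exp 64 * K₁ * (L ^ 10)⁻¹ :=
      mul_le_mul_of_nonneg_left h1310 (by positivity)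
    linarith
  have hKle' : K ≤ ε * π * L := by
    have := hLX
    rwa [div_le_iff₀ (by positivity), mul_comm] at this
  have step3 : K * (L ^ 10)⁻¹ ≤ ε * (π / L ^ 9) := by
    rw [show ε * (π / L ^ 9) = (ε * π * L) * (L ^ 10)⁻¹ by field_simp]
    gcongr
  calc W₁ * A₁ + W₂ * A₂ ≤ _ := step1
    _ = Real.exp 64 * K₁ * (L ^ 13)⁻¹ + 2 * Real.exp 256 * K₂ * (L ^ 10)⁻¹ := by rw [e1, e2]
    _ ≤ K * (L ^ 10)⁻¹ := step2
    _ ≤ ε * (π / L ^ 9) := step3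

/-- At the lower boundary point of the top range the `m`-sum bound `B_M + e_M` is below the
window bound `4𝓛⁻⁵` once `𝓛 ≥ 64e^{9/2} + |C₂|` (and `𝓛 ≥ 5`). [cite: Zhang2022LandauSiegel, §10 p. 57] -/
theorem lopoint_bound {L C : ℝ} (hL5 : 5 ≤ L) (hbig : 64 * Real.exp (9 / 2) + |C| ≤ L) :
    4 * Real.exp (9 / 2) * L ^ 2 * 32 / (0.504 * L ^ 9) + |C| * (L ^ 6)⁻¹ / (0.504 * L ^ 9) ≤
      4 * (L ^ 5)⁻¹ := by
  have hL1 : (1 : ℝ) ≤ L := by linarith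
  have hL0 : (0 : ℝ) < L := by linarith
  have he : 0 < Real.exp (9 / 2) := Real.exp_pos _
  have hC : 0 ≤ |C| := abs_nonneg C
  rw [← add_div, div_le_iff₀ (by positivity)]
  have e : 4 * (L ^ 5)⁻¹ * (0.504 * L ^ 9) = 2.016 * L ^ 4 := by
    field_simp; ring
  rw [e]
  have h6 : (L ^ 6)⁻¹ ≤ 1 := inv_le_one_of_one_le₀ (one_le_pow₀ hL1)
  have hC6 : |C| * (L ^ 6)⁻¹ ≤ |C| * L ^ 3 := by
    calc |C| * (L ^ 6)⁻¹ ≤ |C| * 1 := by gcongr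
      _ ≤ |C| * L ^ 3 := by gcongr; exact one_le_pow₀ hL1
  have hL3 : 0 < L ^ 3 := by positivity
  have hmain : 2 * L ^ 3 * (64 * Real.exp (9 / 2) + |C|) ≤ 2 * L ^ 3 * L :=
    mul_le_mul_of_nonneg_left hbig (by positivity)
  have hsq : L ^ 2 ≤ L ^ 3 := pow_le_pow_right₀ hL1 (by norm_num)
  nlinarith [mul_le_mul_of_nonneg_left hsq (by positivity : (0:ℝ) ≤ 128 * Real.exp (9 / 2)),
    pow_pos hL0 4]

/-! ## The printed main term of the top range -/

/-- The collapsed main term of the assembly IS the printed `n`-sum of (10.12)'s third range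
(`(1 + 𝔶₂ⱼ)` in place of `(−1 + 𝔶₁ⱼ)`; `log P₁ = 0.504 log P`). [cite: Zhang2022LandauSiegel, §10 p. 57] -/
theorem mainTerm_eq_top [NeZero D] (hD : 2 ≤ Real.log D) (j : ℕ) :
    500 * deriv χ.LFunction 1 ^ 2 / (0.504 * Sec10B.logP D ^ 2) *
        Sec10B.nAvg c' χ j (bigP D ^ (0.502 : ℝ)) (bigP D ^ (0.504 : ℝ))
          (fun n => frakfW c' D j 6 (bigP D ^ (0.504 : ℝ) / n) * (1 + fraky2 c' D j n)) =
      ∑ n ∈ (Finset.Ico 1 (Nsupp D)).filter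
          (fun n : ℕ => bigP D ^ (0.502 : ℝ) ≤ (n : ℝ) ∧ (n : ℝ) < bigP D ^ (0.504 : ℝ)),
        ((‖χ (n : ZMod D)‖ : ℂ) * lamZero c' D j n / (n : ℂ)) * ((n : ℂ) / (Nat.totient n : ℂ)) *
          (deriv χ.LFunction 1 * frakfW c' D j 6 (P1 D / n) / (Real.log (P1 D) : ℂ) *
            (500 * deriv χ.LFunction 1 / (Real.log (bigP D) : ℂ)) * (1 + fraky2 c' D j n)) := by
  classical
  have hhiN : bigP D ^ (0.504 : ℝ) < (Nsupp D : ℝ) :=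
    lt_of_lt_of_le (P1_lt_P_div_T_sq D hD) (Nat.le_ceil _)
  have hL0 : 0 < ell D := by rw [ell]; linarith
  have hidx : (Finset.Ico 1 ⌈bigP D ^ (0.504 : ℝ)⌉₊).filter
      (fun n : ℕ => bigP D ^ (0.502 : ℝ) ≤ (n : ℝ)) =
      (Finset.Ico 1 (Nsupp D)).filter
        (fun n : ℕ => bigP D ^ (0.502 : ℝ) ≤ (n : ℝ) ∧ (n : ℝ) < bigP D ^ (0.504 : ℝ)) := by
    ext n
    rw [Finset.mem_filter, Finset.mem_filter, Finset.mem_Ico, Finset.mem_Ico, Nat.lt_ceil]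
    constructor
    · rintro ⟨⟨h1, h2⟩, h3⟩
      exact ⟨⟨h1, by exact_mod_cast (lt_trans h2 hhiN : (n : ℝ) < Nsupp D)⟩, h3, h2⟩
    · rintro ⟨⟨h1, -⟩, h3, h2⟩
      exact ⟨⟨h1, h2⟩, h3⟩
  rw [Sec10B.nAvg, hidx, Finset.mul_sum]
  refine Finset.sum_congr rfl fun n hn => ?_
  have hn0 : (n : ℂ) ≠ 0 := by
    have : 1 ≤ n := (Finset.mem_Ico.mp (Finset.mem_filter.mp hn).1).1
    exact_mod_cast (show n ≠ 0 by omega)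
  have hφ0 : (Nat.totient n : ℂ) ≠ 0 := by
    have : 1 ≤ n := (Finset.mem_Ico.mp (Finset.mem_filter.mp hn).1).1
    exact_mod_cast (Nat.totient_pos.mpr (by omega)).ne'
  have hl0 : (ell D : ℂ) ≠ 0 := by exact_mod_cast hL0.ne'
  have hlogP1C : (Real.log (P1 D) : ℂ) = 0.504 * (ell D : ℂ) ^ 9 := by
    rw [P1, log_bigP_rpow]; push_cast; ring
  have hlogPC : (Sec10B.logP D : ℂ) = (ell D : ℂ) ^ 9 := by
    rw [Sec10B.logP, log_bigP]; push_cast; ring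
  simp only [P1]
  rw [hlogPC, show (Real.log (bigP D ^ (0.504 : ℝ)) : ℂ) = 0.504 * (ell D : ℂ) ^ 9 by
    rw [← P1, hlogP1C]]
  field_simp

/-! ## The main step: `Z22:§10.u038`, first line -/

set_option maxHeartbeats 400000 in
-- one long assembly proof (three windows, two factor estimates); twice the default budget
/-- **`Z22:§10.u038` (first line) DISCHARGED from its cited inputs**: the typed display
`Typed.Sec10B.Eq1038a c′` — "the sum over `P^{0.502} ≤ dr < P^{0.504}` [of `Sⱼ(𝐚₁₁,𝐚₁₃)`] is
equal to `(500L′(1,χ)²/(0.504 log²P)) Σ_{P^{0.502}≤n<P^{0.504}} |χ(n)|λ₀ⱼ(n)φ(n)⁻¹𝔣_{j6}(P^{0.504}/n)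
(1 + 𝔶₂ⱼ(n)) + o(α)`" (§10 p. 57, tex L2941) — FOLLOWS (kernel-checked) from the leaf
`Skeleton.Lemma102 c′` ((10.10), (10.11)), the node `Skeleton.Lemma82 c′` (a tree theorem for
`c′ ≥ 0`) and the typed identity `Section8cStatements.Eq810` ((8.10)), all CLAIMS of the manuscript
taken as hypotheses; the error is `≪ 𝓛⁻¹⁰ = o(𝓛⁻⁹) = o(α)` (the top `T`-window, where Lemma 8.2
does not reach, costs `𝓛^{1.1}` against a saving `𝓛⁻⁵·𝓛⁻⁷`).
[cite: Zhang2022LandauSiegel, §10 p. 57] -/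
theorem eq1038a_of [NeZero D] (h102 : Lemma102 c') (h82 : Lemma82 c')
    (h810 : Section8cStatements.Eq810) : Sec10B.Eq1038a c' := by
  classical
  intro ε hε
  obtain ⟨C₁, H₁⟩ := h102
  obtain ⟨C₂, H₂⟩ := h82
  set K₁ : ℝ := (254 * Real.exp (9 / 2) + 2 * |C₂|) * |C₁| + 8000 * Real.exp (9 / 2) * |C₂|
    with hK₁
  set K₂ : ℝ := 4 * (4000 * Real.exp (9 / 2) + |C₁|) +
    1016000 * (Real.exp (9 / 2) * Real.exp (9 / 2)) with hK₂
  have hK₁0 : 0 ≤ K₁ := by positivity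
  have hK₂0 : 0 ≤ K₂ := by positivity
  set X : ℝ := (Real.exp 64 * K₁ + 2 * Real.exp 256 * K₂) / (ε * π) + 5 +
    (64 * Real.exp (9 / 2) + |C₂|) with hX
  obtain ⟨D₀, hH⟩ := H₁.and H₂
  refine ⟨max D₀ (max ⌈Real.exp (π * |c'| + 5)⌉₊ ⌈Real.exp X⌉₊), fun D _ χ hD hq hp hA j hj => ?_⟩
  have hD₀ : D₀ ≤ D := le_trans (le_max_left _ _) hD
  have hDc : ⌈Real.exp (π * |c'| + 5)⌉₊ ≤ D :=
    le_trans (le_trans (le_max_left _ _) (le_max_right _ _)) hD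
  have hDX : ⌈Real.exp X⌉₊ ≤ D := le_trans (le_trans (le_max_right _ _) (le_max_right _ _)) hD
  obtain ⟨hL5, hα, hcαL⟩ := large_D hDc
  have hLX : X ≤ ell D := by
    have h : Real.exp X ≤ D := le_trans (Nat.le_ceil _) (by exact_mod_cast hDX)
    rw [ell]; exact (Real.le_log_iff_exp_le (lt_of_lt_of_le (Real.exp_pos _) h)).mpr h
  obtain ⟨H₁', H₂'⟩ := hH D χ hD₀ hq hp
  replace H₁' := H₁' hA j hj
  replace H₂' := H₂' hA j hj 6 (by simp)
  -- parameters
  have hlog2 : 2 ≤ Real.log D := by have h := hL5; rw [ell] at h; linarith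
  have hL1 : (1 : ℝ) ≤ ell D := by linarith
  have hL0 : (0 : ℝ) < ell D := by linarith
  have hαeq : alpha D = π / ell D ^ 9 := by rw [alpha, bigP, Real.log_exp]
  have hαL : alpha D * ell D ^ 9 = π := by rw [hαeq]; field_simp
  obtain ⟨-, hP2lo5, hT1, hP1⟩ := range_sizes (D := D) hlog2
  obtain ⟨h11, -⟩ := bigT_lt_rpow hL5
  have hhiN : bigP D ^ (0.504 : ℝ) < (Nsupp D : ℝ) :=
    lt_of_lt_of_le (P1_lt_P_div_T_sq D hlog2) (Nat.le_ceil _)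
  have hMT0 := mainTerm_eq_top c' χ hlog2 j
  have hreidx0 := drSum_reindex c' χ j (Sec10B.mSum11 c' χ j) (Sec10B.nSum13 c' χ j)
    (lo := bigP D ^ (0.502 : ℝ)) hhiN
  have h59 : (1953125 : ℝ) ≤ ell D ^ 9 := by
    have h := pow_le_pow_left₀ (by norm_num : (0:ℝ) ≤ 5) hL5 9
    norm_num at h
    exact h
  have h7L : (78125 : ℝ) * ell D ^ 2 ≤ ell D ^ 9 := by
    have hL7 : (78125 : ℝ) ≤ ell D ^ 7 := by
      have h := pow_le_pow_left₀ (by norm_num : (0:ℝ) ≤ 5) hL5 7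
      norm_num at h
      exact h
    calc (78125 : ℝ) * ell D ^ 2 ≤ ell D ^ 7 * ell D ^ 2 := by gcongr
      _ = ell D ^ 9 := by ring
  have hP2lo_raw : P2 D ≤ bigP D ^ (0.502 : ℝ) := by
    refine hP2lo5.trans ?_
    rw [bigP_rpow, bigP_rpow, Real.exp_le_exp]
    linarith [h59]
  set P : ℝ := bigP D with hPdef
  set lo : ℝ := bigP D ^ (0.502 : ℝ) with hlodef
  set hi : ℝ := bigP D ^ (0.504 : ℝ) with hhidef
  set T : ℝ := bigT D with hTdef
  have hlo_exp : lo = Real.exp (0.502 * ell D ^ 9) := bigP_rpow D 0.502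
  have hhi_exp : hi = Real.exp (0.504 * ell D ^ 9) := bigP_rpow D 0.504
  have hP1_exp : P1 D = Real.exp (0.504 * ell D ^ 9) := bigP_rpow D 0.504
  have hlogP : Real.log P = ell D ^ 9 := log_bigP D
  have hT_exp : T = Real.exp (ell D ^ (1.1 : ℝ)) := rfl
  set M : ℕ → ℂ := Sec10B.mSum11 c' χ j with hMdef
  set N : ℕ → ℕ → ℂ := Sec10B.nSum13 c' χ j with hNdef
  set S : Finset ℕ := (Finset.Ico 1 (Nsupp D)).filter (fun n : ℕ => lo ≤ (n : ℝ) ∧ (n : ℝ) < hi)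
    with hSdef
  clear_value P lo hi T M N S
  have hP0 : 0 < P := lt_trans zero_lt_one hP1
  have hlo0 : 0 < lo := by rw [hlo_exp]; exact Real.exp_pos _
  have hhi0 : 0 < hi := by rw [hhi_exp]; exact Real.exp_pos _
  have hT0 : 0 < T := lt_of_lt_of_le zero_lt_one hT1
  have hT1' : 1 < T := by
    rw [hT_exp]; exact Real.one_lt_exp_iff.mpr (Real.rpow_pos_of_pos hL0 _)
  have hP1pos : 0 < P1 D := by rw [hP1_exp]; exact Real.exp_pos _
  have hlogP1 : Real.log (P1 D) = 0.504 * ell D ^ 9 := by rw [hP1_exp, Real.log_exp]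
  have hlogP1pos : 0 < Real.log (P1 D) := by rw [hlogP1]; positivity
  have hlogT : Real.log T = ell D ^ (1.1 : ℝ) := by rw [hT_exp, Real.log_exp]
  have hhiT_exp : hi / T = Real.exp (0.504 * ell D ^ 9 - ell D ^ (1.1 : ℝ)) := by
    rw [hhi_exp, hT_exp, ← Real.exp_sub]
  have hP2lo : P2 D ≤ lo := hP2lo_raw
  have hlohiT : lo < hi / T := by
    rw [hlo_exp, hhiT_exp, Real.exp_lt_exp]
    have h2pos : 0 < ell D ^ 2 := pow_pos hL0 2
    linarith [h11, h7L]
  -- opaque objects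
  obtain ⟨a, hadef⟩ : ∃ a : ℕ → ℂ, a = fun n : ℕ => (‖χ (n : ZMod D)‖ : ℂ) * lamZero c' D j n / (n : ℂ) :=
    ⟨_, rfl⟩
  obtain ⟨M₀, hM₀def⟩ : ∃ M₀ : ℕ → ℂ, M₀ = fun n : ℕ => deriv χ.LFunction 1 *
      frakfW c' D j 6 (P1 D / n) / (Real.log (P1 D) : ℂ) := ⟨_, rfl⟩
  obtain ⟨G, hGdef⟩ : ∃ G : ℕ → ℂ, G = fun n : ℕ => 1 + fraky2 c' D j n := ⟨_, rfl⟩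
  obtain ⟨c₀, hc₀def⟩ : ∃ c₀ : ℂ, c₀ = 500 * deriv χ.LFunction 1 / (Real.log P : ℂ) := ⟨_, rfl⟩
  obtain ⟨main, hmaindef⟩ : ∃ main : ℕ → Prop, main = fun n : ℕ => lo < (n : ℝ) ∧ (n : ℝ) < hi / T :=
    ⟨_, rfl⟩
  have hmemS : ∀ {n : ℕ}, n ∈ S → 1 ≤ n ∧ lo ≤ (n : ℝ) ∧ (n : ℝ) < hi := by
    intro n hn
    rw [hSdef, Finset.mem_filter, Finset.mem_Ico] at hn
    exact ⟨hn.1.1, hn.2.1, hn.2.2⟩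
  have hSne : ∀ n ∈ S, n ≠ 0 := fun n hn => by have := (hmemS hn).1; omega
  -- (A) re-indexing
  have hreidx : Sec10B.drSum c' χ j M N lo hi =
      ∑ n ∈ S, ∑ r ∈ n.divisors,
        (if Squarefree r then a n / (Nat.totient r : ℂ) * M n * N (n / r) r else 0) := by
    rw [hadef]; exact hreidx0
  -- (B) hypotheses
  have hμ6 : betaMu D 6 = beta6 D := by simp [betaMu]
  have hxfacts : ∀ {n : ℕ}, n ∈ S →
      1 ≤ P1 D / n ∧ P1 D / n < P ∧ 0 ≤ Real.log (P1 D / n) ∧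
      Real.log (P1 D / n) ≤ 0.002 * ell D ^ 9 ∧ |Real.log (hi / n)| ≤ 0.004 * ell D ^ 9 ∧
      ((n : ℝ) < hi / T → T < P1 D / n) ∧ (hi / T ≤ (n : ℝ) → Real.log (P1 D / n) ≤ ell D ^ (1.1 : ℝ)) := by
    intro n hn
    obtain ⟨hn1, hlon, hnhi⟩ := hmemS hn
    rw [hlodef] at hlon
    rw [hhidef] at hnhi ⊢
    rw [hTdef, hPdef]
    exact range_xfacts_top hL5 hn1 hlon hnhi
  have hLp : ‖deriv χ.LFunction 1‖ ≤ 4 * Real.exp (9 / 2) * ell D ^ 2 :=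
    norm_deriv_LFunction_one_le χ (by linarith) hp
  -- (B1) `M = M₀ + O(eM)` for `n < hi/T`
  have hMfull : ∀ n ∈ S, (n : ℝ) < hi / T →
      ‖M n - M₀ n‖ ≤ |C₂| * (ell D ^ 6)⁻¹ / (0.504 * ell D ^ 9) := by
    intro n hn hnT
    obtain ⟨hn1, hlon, hnhi⟩ := hmemS hn
    obtain ⟨-, hxP, -, -, -, hTx, -⟩ := hxfacts hn
    have hTx := hTx hnT
    have hP2n : P2 D ≤ (n : ℝ) := hP2lo.trans hlon
    have hMn : M n = (1 / (Real.log (P1 D) : ℂ)) * ∑ m ∈ Finset.Ico 1 ⌈P1 D / n⌉₊,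
        χ (m : ZMod D) / (m : ℂ) ^ (1 - betaJ c' D j) *
          (((P1 D / n) / m : ℝ) : ℂ) ^ beta6 D * (Real.log ((P1 D / n) / m) : ℂ) := by
      rw [hMdef]; exact mSum11_eq c' χ hlog2 j hn1 hP2n
    have h82 := H₂' (P1 D / n) hTx hxP
    rw [hμ6] at h82
    have hdiff : M n - M₀ n = (1 / (Real.log (P1 D) : ℂ)) *
        ((∑ m ∈ Finset.Ico 1 ⌈P1 D / n⌉₊, χ (m : ZMod D) / (m : ℂ) ^ (1 - betaJ c' D j) *
          (((P1 D / n) / m : ℝ) : ℂ) ^ beta6 D * (Real.log ((P1 D / n) / m) : ℂ)) -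
          deriv χ.LFunction 1 * frakfW c' D j 6 (P1 D / n)) := by
      rw [hMn, hM₀def]
      have : (Real.log (P1 D) : ℂ) ≠ 0 := by exact_mod_cast hlogP1pos.ne'
      field_simp
    rw [hdiff, norm_mul, norm_div, norm_one, Complex.norm_real, Real.norm_of_nonneg hlogP1pos.le,
      hlogP1]
    have h82' := h82.trans (mul_le_mul_of_nonneg_right (le_abs_self C₂) (by positivity))
    calc 1 / (0.504 * ell D ^ 9) * _ ≤ 1 / (0.504 * ell D ^ 9) * (|C₂| * (ell D ^ 6)⁻¹) := by
          gcongr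
      _ = |C₂| * (ell D ^ 6)⁻¹ / (0.504 * ell D ^ 9) := by ring
  have hM : ∀ n ∈ S, main n → ‖M n - M₀ n‖ ≤ |C₂| * (ell D ^ 6)⁻¹ / (0.504 * ell D ^ 9) := by
    intro n hn hmain
    have hmain' : lo < (n : ℝ) ∧ (n : ℝ) < hi / T := by rw [hmaindef] at hmain; exact hmain
    exact hMfull n hn hmain'.2
  -- (B2) `|M₀| ≤ BM`
  have hM₀ : ∀ n ∈ S, ‖M₀ n‖ ≤ 4 * Real.exp (9 / 2) * ell D ^ 2 * 32 / (0.504 * ell D ^ 9) := by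
    intro n hn
    obtain ⟨-, -, hlx0, hlx, -, -, -⟩ := hxfacts hn
    have hlx' : |Real.log (P1 D / n)| ≤ ell D ^ 9 := by
      rw [abs_of_nonneg hlx0]; linarith [h59]
    have hf := norm_frakfW_six_le hcαL hα hαL hL0.le j hlx'
    rw [hM₀def]
    simp only
    rw [norm_div, norm_mul, Complex.norm_real, Real.norm_of_nonneg hlogP1pos.le, hlogP1]
    gcongr
  -- (B2') crude `|M| ≤ BW` on the window
  have hMW : ∀ n ∈ S, ¬ main n → ‖M n‖ ≤ 4 * (ell D ^ 5)⁻¹ := by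
    intro n hn hmain
    obtain ⟨hn1, hlon, hnhi⟩ := hmemS hn
    obtain ⟨hx1, -, hlx0, hlx2, -, -, hlxT⟩ := hxfacts hn
    have hP2n : P2 D ≤ (n : ℝ) := hP2lo.trans hlon
    rw [hmaindef] at hmain
    simp only [not_and_or, not_lt] at hmain
    rcases hmain with h | h
    · -- the point `n = P^{0.502}`: `M ≈ M₀`, `|M₀| ≤ BM`, and `BM + eM ≤ 4𝓛⁻⁵` for `𝓛 ≥ X`
      have hnT : (n : ℝ) < hi / T := lt_of_le_of_lt h hlohiT
      have h1 := hMfull n hn hnT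
      have h2 := hM₀ n hn
      have h3 : ‖M n‖ ≤ ‖M₀ n‖ + ‖M n - M₀ n‖ := norm_le_norm_add_norm_sub' (M n) (M₀ n)
      have hLbig : 64 * Real.exp (9 / 2) + |C₂| ≤ ell D := by
        rw [hX] at hLX
        linarith [show (0:ℝ) ≤ (Real.exp 64 * K₁ + 2 * Real.exp 256 * K₂) / (ε * π) by
          positivity]
      have hsum := lopoint_bound (C := C₂) hL5 hLbig
      linarith
    · -- the top window `n ≥ P₁/T`: crude harmonic bound
      have hlxT := hlxT h
      have hMn : M n = (1 / (Real.log (P1 D) : ℂ)) * ∑ m ∈ Finset.Ico 1 ⌈P1 D / n⌉₊,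
          χ (m : ZMod D) / (m : ℂ) ^ (1 - betaJ c' D j) *
            (((P1 D / n) / m : ℝ) : ℂ) ^ beta6 D * (Real.log ((P1 D / n) / m) : ℂ) := by
        rw [hMdef]; exact mSum11_eq c' χ hlog2 j hn1 hP2n
      have hcr := norm_lemma82Sum_crude c' χ j hx1
      rw [hMn, norm_mul, norm_div, norm_one, Complex.norm_real, Real.norm_of_nonneg hlogP1pos.le,
        hlogP1]
      have hlogx_le : Real.log (P1 D / n) ≤ ell D ^ 2 := hlxT.trans h11
      have hbound : (1 + Real.log (P1 D / n)) * Real.log (P1 D / n) ≤ 2 * ell D ^ 4 := by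
        have hl2 : (1 : ℝ) ≤ ell D ^ 2 := one_le_pow₀ hL1
        calc (1 + Real.log (P1 D / n)) * Real.log (P1 D / n)
            ≤ (1 + ell D ^ 2) * ell D ^ 2 :=
              mul_le_mul (by linarith) hlogx_le hlx0 (by positivity)
          _ ≤ (ell D ^ 2 + ell D ^ 2) * ell D ^ 2 := by gcongr
          _ = 2 * ell D ^ 4 := by ring
      calc 1 / (0.504 * ell D ^ 9) * _ ≤ 1 / (0.504 * ell D ^ 9) * (2 * ell D ^ 4) := by
            gcongr; exact hcr.trans hbound
        _ = (2 / 0.504) * (ell D ^ 5)⁻¹ := by field_simp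
        _ ≤ 4 * (ell D ^ 5)⁻¹ := by gcongr; norm_num
  -- (B3) `|G| ≤ 2`
  have hG : ∀ n ∈ S, ‖G n‖ ≤ 2 := by
    intro n hn
    obtain ⟨-, -, -, -, h2, -, -⟩ := hxfacts hn
    rw [hhidef] at h2
    rw [hGdef]
    exact norm_fraky2_add_le hcαL hα hαL hL0.le j h2
  -- (B4) main `n`: (10.10)
  have hN : ∀ n ∈ S, main n → ∀ r ∈ n.divisors, Squarefree r →
      ‖N (n / r) r - c₀ * PiW χ (n / r) r * G n‖ ≤ |C₁| * (ell D ^ 15)⁻¹ := by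
    intro n hn hmain r hr _
    obtain ⟨hn1, -, -⟩ := hmemS hn
    have hr0 : 0 < r := Nat.pos_of_mem_divisors hr
    have hrn : r ∣ n := (Nat.mem_divisors.mp hr).1
    have hnr : n / r * r = n := Nat.div_mul_cancel hrn
    have hd1 : 1 ≤ n / r := Nat.div_pos (Nat.le_of_dvd (by omega) hrn) hr0
    have hcast : ((n / r * r : ℕ) : ℝ) = n := by rw [hnr]
    have hNeq : N (n / r) r = frakv2 c' χ j (n / r) r := by
      rw [hNdef]; exact nSum13_eq_frakv2 c' χ hlog2 j hd1 hr0
    have hmain' : lo < (n : ℝ) ∧ (n : ℝ) < hi / T := by rw [hmaindef] at hmain; exact hmain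
    have h := (H₁' (n / r) r hd1 hr0).2.2.1 (by rw [hcast]; exact hmain'.1)
      (by rw [hcast]; exact hmain'.2.le)
    rw [hcast] at h
    rw [hNeq, hGdef, hc₀def]
    simp only
    refine le_trans (le_of_eq ?_) (h.trans ?_)
    · congr 1; ring
    · exact mul_le_mul_of_nonneg_right (le_abs_self _) (by positivity)
  -- (B5) window `n`: (10.11), or (10.10) at the boundary point `n = P₁/T`
  have hc₀' : ‖c₀‖ ≤ 2000 * Real.exp (9 / 2) * (ell D ^ 7)⁻¹ := by
    rw [hc₀def, norm_div, norm_mul, Complex.norm_real, Real.norm_of_nonneg (by rw [hlogP]; positivity),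
      hlogP]
    have h500 : ‖(500 : ℂ)‖ = 500 := by norm_num
    rw [h500, div_eq_mul_inv]
    have : (2000 : ℝ) * Real.exp (9 / 2) * (ell D ^ 7)⁻¹ =
        500 * (4 * Real.exp (9 / 2) * ell D ^ 2) * (ell D ^ 9)⁻¹ := by
      field_simp; ring
    rw [this]
    gcongr
  have hW : ∀ n ∈ S, ¬ main n → ∀ r ∈ n.divisors, Squarefree r →
      ‖N (n / r) r‖ ≤ (4000 * Real.exp (9 / 2) + |C₁|) * (ell D ^ 7)⁻¹ *
        ((n : ℝ) / Nat.totient n) ^ 2 := by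
    intro n hn hmain r hr _
    obtain ⟨hn1, hlon, hnhi⟩ := hmemS hn
    have hr0 : 0 < r := Nat.pos_of_mem_divisors hr
    have hrn : r ∣ n := (Nat.mem_divisors.mp hr).1
    have hnr : n / r * r = n := Nat.div_mul_cancel hrn
    have hd1 : 1 ≤ n / r := Nat.div_pos (Nat.le_of_dvd (by omega) hrn) hr0
    have hcast : ((n / r * r : ℕ) : ℝ) = n := by rw [hnr]
    have hNeq : N (n / r) r = frakv2 c' χ j (n / r) r := by
      rw [hNdef]; exact nSum13_eq_frakv2 c' χ hlog2 j hd1 hr0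
    have hΛ : (1 : ℝ) ≤ ((n : ℝ) / Nat.totient n) ^ 2 := one_le_pow₀ (one_le_self_div_totient (by omega))
    have hl15_le_l7 : (ell D ^ 15)⁻¹ ≤ (ell D ^ 7)⁻¹ := by
      rw [inv_le_inv₀ (by positivity) (by positivity)]
      exact pow_le_pow_right₀ hL1 (by norm_num)
    rw [hmaindef] at hmain
    simp only [not_and_or, not_lt] at hmain
    -- the generic window bound from `‖N‖ ≤ |C₁|𝓛⁻⁷`
    have from_window : ‖frakv2 c' χ j (n / r) r‖ ≤ C₁ * (ell D ^ 7)⁻¹ →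
        ‖N (n / r) r‖ ≤ (4000 * Real.exp (9 / 2) + |C₁|) * (ell D ^ 7)⁻¹ *
          ((n : ℝ) / Nat.totient n) ^ 2 := by
      intro hw
      rw [hNeq]
      calc ‖frakv2 c' χ j (n / r) r‖ ≤ |C₁| * (ell D ^ 7)⁻¹ :=
            hw.trans (mul_le_mul_of_nonneg_right (le_abs_self _) (by positivity))
        _ ≤ (4000 * Real.exp (9 / 2) + |C₁|) * (ell D ^ 7)⁻¹ * 1 := by
            rw [mul_one]; gcongr; linarith [Real.exp_pos (9 / 2)]
        _ ≤ _ := by gcongr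
    rcases hmain with h | h
    · -- `n = P^{0.502}`: second window of (10.11)
      refine from_window ((H₁' (n / r) r hd1 hr0).2.2.2 ?_)
      rw [hcast]
      right; left
      exact ⟨lt_of_lt_of_le (div_lt_self hlo0 hT1') hlon, h⟩
    · rcases lt_or_eq_of_le h with h' | h'
      · -- `n > P₁/T`: third window of (10.11)
        refine from_window ((H₁' (n / r) r hd1 hr0).2.2.2 ?_)
        rw [hcast]
        right; right
        exact ⟨h', hnhi⟩
      · -- `n = P₁/T`: (10.10) gives the main-term form; bound it crudely
        have h10 := (H₁' (n / r) r hd1 hr0).2.2.1 (by rw [hcast, ← h']; exact hlohiT)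
          (by rw [hcast, ← h'])
        rw [hcast] at h10
        have hPiW := norm_PiW_le χ (d := n / r) (r := r) (by omega) (by omega)
        rw [hnr] at hPiW
        have hG2 : ‖(1 : ℂ) + fraky2 c' D j n‖ ≤ 2 := by
          have := hG n hn; rw [hGdef] at this; exact this
        have hmainterm : ‖500 * deriv χ.LFunction 1 * PiW χ (n / r) r / (Real.log P : ℂ) *
            (1 + fraky2 c' D j n)‖ ≤ 4000 * Real.exp (9 / 2) * (ell D ^ 7)⁻¹ *
              ((n : ℝ) / Nat.totient n) ^ 2 := by
          have e : 500 * deriv χ.LFunction 1 * PiW χ (n / r) r / (Real.log P : ℂ) *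
              (1 + fraky2 c' D j n) = c₀ * PiW χ (n / r) r * (1 + fraky2 c' D j n) := by
            rw [hc₀def]; ring
          rw [e, norm_mul, norm_mul]
          calc ‖c₀‖ * ‖PiW χ (n / r) r‖ * ‖(1 : ℂ) + fraky2 c' D j n‖
              ≤ (2000 * Real.exp (9 / 2) * (ell D ^ 7)⁻¹) * ((n : ℝ) / Nat.totient n) ^ 2 * 2 := by
                gcongr
            _ = 4000 * Real.exp (9 / 2) * (ell D ^ 7)⁻¹ * ((n : ℝ) / Nat.totient n) ^ 2 := by ring
        rw [hNeq]
        have hsplit : ‖frakv2 c' χ j (n / r) r‖ ≤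
            ‖500 * deriv χ.LFunction 1 * PiW χ (n / r) r / (Real.log P : ℂ) * (1 + fraky2 c' D j n)‖ +
              C₁ * (ell D ^ 15)⁻¹ := by
          have := norm_le_norm_add_norm_sub' (frakv2 c' χ j (n / r) r)
            (500 * deriv χ.LFunction 1 * PiW χ (n / r) r / (Real.log P : ℂ) * (1 + fraky2 c' D j n))
          linarith
        calc ‖frakv2 c' χ j (n / r) r‖
            ≤ 4000 * Real.exp (9 / 2) * (ell D ^ 7)⁻¹ * ((n : ℝ) / Nat.totient n) ^ 2 +
              |C₁| * (ell D ^ 7)⁻¹ * ((n : ℝ) / Nat.totient n) ^ 2 := by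
              refine hsplit.trans (add_le_add hmainterm ?_)
              calc C₁ * (ell D ^ 15)⁻¹ ≤ |C₁| * (ell D ^ 15)⁻¹ :=
                    mul_le_mul_of_nonneg_right (le_abs_self _) (by positivity)
                _ ≤ |C₁| * (ell D ^ 7)⁻¹ * 1 := by rw [mul_one]; gcongr
                _ ≤ |C₁| * (ell D ^ 7)⁻¹ * ((n : ℝ) / Nat.totient n) ^ 2 := by gcongr
          _ = (4000 * Real.exp (9 / 2) + |C₁|) * (ell D ^ 7)⁻¹ * ((n : ℝ) / Nat.totient n) ^ 2 := by
              ring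
  -- (B6) collapse
  have hPi : ∀ n ∈ S, main n →
      ∑ r ∈ n.divisors with Squarefree r, (1 / (Nat.totient r : ℂ)) * PiW χ (n / r) r =
        (n : ℂ) / (Nat.totient n : ℂ) := fun n hn _ => h810 D χ hq n (hSne n hn)
  -- (C) abstract assembly (window variant)
  have heM0 : 0 ≤ |C₂| * (ell D ^ 6)⁻¹ / (0.504 * ell D ^ 9) := by positivity
  have hBM0 : 0 ≤ 4 * Real.exp (9 / 2) * ell D ^ 2 * 32 / (0.504 * ell D ^ 9) := by positivity
  have hBW0 : (0 : ℝ) ≤ 4 * (ell D ^ 5)⁻¹ := by positivity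
  have hRA := range_assembly_bound₂ hSne main a M M₀ G N (PiW χ) c₀ heM0 hBM0 hBW0 hPi hM hM₀
    hMW hG hN hW
  -- (D) main term, weights, constants
  have hMT : 500 * deriv χ.LFunction 1 ^ 2 / (0.504 * Sec10B.logP D ^ 2) *
        Sec10B.nAvg c' χ j lo hi
          (fun n => frakfW c' D j 6 (hi / n) * (1 + fraky2 c' D j n)) =
      ∑ n ∈ S, a n * ((n : ℂ) / (Nat.totient n : ℂ)) * (M₀ n * c₀ * G n) := by
    rw [hadef, hM₀def, hGdef, hc₀def]
    exact hMT0
  have hweight : ∀ n ∈ S, ∀ k : ℕ, ‖a n‖ * ((n : ℝ) / Nat.totient n) ^ k ≤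
      ((n : ℝ) / Nat.totient n) ^ (k + 4) / n := by
    intro n hn k
    have hn0 := hSne n hn
    have hnpos : (0 : ℝ) < n := by exact_mod_cast Nat.pos_of_ne_zero hn0
    have hχ : ‖χ (n : ZMod D)‖ ≤ 1 := DirichletCharacter.norm_le_one χ _
    have hlam := norm_lamZero_le c' D j hn0
    have hr1 := one_le_self_div_totient hn0
    rw [hadef]
    simp only
    rw [norm_div, norm_mul, Complex.norm_real, Real.norm_eq_abs, abs_norm, Complex.norm_natCast]
    calc ‖χ (n : ZMod D)‖ * ‖lamZero c' D j n‖ / n * ((n : ℝ) / Nat.totient n) ^ k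
        ≤ 1 * ((n : ℝ) / Nat.totient n) ^ 4 / n * ((n : ℝ) / Nat.totient n) ^ k := by gcongr
      _ = ((n : ℝ) / Nat.totient n) ^ (k + 4) / n := by ring
  have hWmain_le : ∑ n ∈ S.filter main, ‖a n‖ * ((n : ℝ) / Nat.totient n) ≤
      Real.exp 64 * ell D ^ 9 := by
    have hfull := weight_sum_exp_range 5 (A := 0.502 * ell D ^ 9) (B := 0.504 * ell D ^ 9)
      (by linarith [h59]) (by linarith [h59]) S (fun n hn => by
        obtain ⟨h1, h2, h3⟩ := hmemS hn
        rw [hlo_exp] at h2; rw [hhi_exp] at h3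
        exact ⟨h1, h2, h3⟩)
    have h64 : Real.exp (2 ^ (5 + 1)) = Real.exp 64 := by norm_num
    rw [h64] at hfull
    calc ∑ n ∈ S.filter main, ‖a n‖ * ((n : ℝ) / Nat.totient n)
        ≤ ∑ n ∈ S.filter main, ((n : ℝ) / Nat.totient n) ^ 5 / n :=
          Finset.sum_le_sum fun n hn => by
            have := hweight n (Finset.mem_of_mem_filter n hn) 1
            simpa using this
      _ ≤ ∑ n ∈ S, ((n : ℝ) / Nat.totient n) ^ 5 / n :=
          Finset.sum_le_sum_of_subset_of_nonneg (Finset.filter_subset _ _) fun n _ _ => by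
            positivity
      _ ≤ Real.exp 64 * (2 + (0.504 * ell D ^ 9 - 0.502 * ell D ^ 9)) := hfull
      _ ≤ Real.exp 64 * ell D ^ 9 := by gcongr; linarith [h59]
  have hWwin_le : ∑ n ∈ S.filter (fun n => ¬ main n), ‖a n‖ * ((n : ℝ) / Nat.totient n) ^ 3 ≤
      2 * Real.exp 256 * ell D ^ 2 := by
    have hwin := weight_sum_windows 7 (A := 0.502 * ell D ^ 9) (B := 0.504 * ell D ^ 9)
      (τ := ell D ^ (1.1 : ℝ)) (by linarith [h59]) (by positivity)
      (by have h2pos : 0 < ell D ^ 2 := pow_pos hL0 2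
          linarith [h11, h7L])
      (S.filter (fun n => ¬ main n)) (fun n hn => by
        rw [Finset.mem_filter] at hn
        obtain ⟨hnS, hnm⟩ := hn
        obtain ⟨h1, h2, h3⟩ := hmemS hnS
        rw [hmaindef] at hnm
        simp only [not_and_or, not_lt] at hnm
        refine ⟨h1, ?_⟩
        rcases hnm with h | h
        · left; rw [← hlo_exp]; exact ⟨h2, h⟩
        · right
          rw [← hhiT_exp, ← hhi_exp]
          exact ⟨h, h3⟩)
    have h256 : Real.exp (2 ^ (7 + 1)) = Real.exp 256 := by norm_num
    rw [h256] at hwin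
    calc ∑ n ∈ S.filter (fun n => ¬ main n), ‖a n‖ * ((n : ℝ) / Nat.totient n) ^ 3
        ≤ ∑ n ∈ S.filter (fun n => ¬ main n), ((n : ℝ) / Nat.totient n) ^ 7 / n :=
          Finset.sum_le_sum fun n hn => hweight n (Finset.mem_of_mem_filter n hn) 3
      _ ≤ Real.exp 256 * (5 + ell D ^ (1.1 : ℝ)) := hwin
      _ ≤ Real.exp 256 * (2 * ell D ^ 2) := by
          gcongr
          have h25 : (25 : ℝ) ≤ ell D ^ 2 := by
            have h := pow_le_pow_left₀ (by norm_num : (0:ℝ) ≤ 5) hL5 2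
            norm_num at h
            exact h
          linarith [h11]
      _ = 2 * Real.exp 256 * ell D ^ 2 := by ring
  obtain ⟨hKmain, hKwin⟩ := consts_bound_top (C₁ := C₁) (C₂ := C₂) hL5 (norm_nonneg c₀) hc₀'
  -- (E) conclusion
  rw [hreidx, hMT]
  refine hRA.trans ?_
  rw [hαeq]
  have hLX' : (Real.exp 64 * K₁ + 2 * Real.exp 256 * K₂) / (ε * π) ≤ ell D := by
    rw [hX] at hLX
    linarith [show (0 : ℝ) ≤ 64 * Real.exp (9 / 2) + |C₂| by positivity]
  exact final_bound_top hL1 hε hK₁0 hK₂0 (by positivity) (by positivity)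
    hWmain_le hWwin_le hKmain hKwin hLX'

end Literature.NumberTheory.LFunctions.Zhang2022.Skeleton
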